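import Mathlib
import Literature.Analysis.FluidPDE.SuitableWeak
import Literature.Analysis.FluidPDE.WeakGradientSlicing
import Literature.Analysis.FluidPDE.SpaceTimeRescaling
import Literature.Analysis.FluidPDE.LocalEnergyTimeShift
import Summits.NavierStokesRegularity.NavierStokesRegularity.Theorems.EulerZoomLiouvillePowerGaugeEulerLiouvilleBackwardTools
import Summits.NavierStokesRegularity.NavierStokesRegularity.Theorems.EulerZoomLiouvillePowerGaugeEulerLiouvilleTimePeriodicTools
import Summits.NavierStokesRegularity.NavierStokesRegularity.Theorems.EulerZoomLiouvillePowerGaugeEulerLiouvilleSteadyTools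
import Summits.NavierStokesRegularity.NavierStokesRegularity.Theorems.EulerZoomLiouvillePowerGaugeEulerLiouvilleAllRhoStrata
import Summits.NavierStokesRegularity.NavierStokesRegularity.Theorems.EulerZoomLiouvillePowerGaugeEulerLiouvilleSelfSimilarPastExtension
import HarnessLib

/-!
# Crux E `PowerGaugeEulerLiouville` (stmt-NavierStokesRegularity-19832): members with a TIME-PERIODIC PAST are trivial

Route `EulerZoomLiouville` (NavierStokesRegularity), crux E = Seregin's power-gauged ancient-Euler Liouville
statement.  The tree's time-periodic stratum `powerGaugeEulerLiouville_timePeriodic` (`…TimePeriodic.lean`,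
ns-typeII-p3) assumes `u(τ − P) = u(τ)` for EVERY `τ < 0`.  Here the periodicity is assumed only in the FAR PAST:
`u(τ − P, ·) = u(τ, ·)` for every `τ < T₁`, some `T₁ ≤ 0`, `P > 0` — NOTHING on `[T₁, 0)`, no regularity beyond
the class — and the member still vanishes a.e. on the whole slab
(`PastPeriodic.ae_eq_zero_of_gauge_of_pastTimePeriodic`).  This contains the PAST-STEADY stratum
(`…PastSteady.lean`, every period) and completes the "past programme" of the lead skeleton
`Cruxes/PowerGaugeEulerLiouville/Lines/birth.lean` for the strata decided by large-scale gauge arithmetic.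

Proof.  Time-translate the past: `ũ(s) = u(T₁ + s)`, `H̃(s) = H(T₁ + s)` (`s < 0`); `H̃` is a weak spatial
gradient of `ũ` on the slab (`HasWeakSpatialGradientOn.stRescale`) and `ũ` is `P`-periodic on the WHOLE slab, so
the period-box bookkeeping of `…TimePeriodicTools.lean` applies to `H̃`
(`TimePeriodic.weakGradient_ae_shift_of_periodic`, `TimePeriodic.mul_periodBox_le`): `n` period boxes of `H̃`
fit in the window `(T₁ − nP′, T₁) × B_R ⊆ Q_a(0)` of the ORIGINAL gradient, `a² ≥ nP′ + |T₁|`, whose mass is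
`≤ c a^{1−ρ}` by the `E`-gauge (`TimePeriodic.setLIntegral_window_le_of_gaugeE`) — only LARGE scales of the
original member are used (the translated pair is NOT a class member: its small-scale gauges at the origin are
those of `u` at `(T₁, 0)`).  Hence every period box has zero mass, `H̃ = 0` a.e., a.e. slice of `ũ` has the
zero weak derivative and is a.e. constant (`ae_eq_const_of_hasWeakFDerivOn_zero`), the `A`-gauge kills the
constant (`lintegral_slice_eq_zero_of_ae_const_of_gaugeA`), so `∫ |u(τ)|² = 0` for a.e. `τ < T₁`: an
energy-quiescent past, and `ae_eq_zero_of_gauge_of_energyVanishing_allRho` concludes.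
WHAT THIS IS NOT: not NS regularity, not the crux `E` — a WEAK past stratum of it (interim LEAD ns-typeII-p2 g9).
-/

noncomputable section

set_option linter.dupNamespace false

open MeasureTheory Set Filter Topology Metric Function TopologicalSpace
open scoped ENNReal NNReal

namespace Summit.NavierStokesRegularity.NavierStokesRegularity.Theorems.PowerGaugeEulerLiouville.PastPeriodic

open Literature.Analysis Literature.Analysis.FunctionSpaces Literature.Analysis.FluidPDE

/-- **An a.e. constant slice of a member with bounded `a^{2ρ} A(a)` has zero energy** (`ρ > 0`): if
`u(τ) = b` a.e. for some `τ < 0`, the `A`-gauge on the slice `τ` at the scales `L ≥ √(−τ) + 1`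
(`Backward.lintegral_ball_le_of_gaugeA`) gives `‖b‖² |B_L| ≤ c L^{1−2ρ}`, so `b = 0`
(`Shifted.growth_of_growth_le`, `NoDrift.eq_zero_of_const_of_lintegral_ball_le`) and `∫ |u(τ)|² = 0`. [folklore] -/
theorem lintegral_slice_eq_zero_of_ae_const_of_gaugeA {ρ : ℝ} (hρ : 0 < ρ)
    {u : ℝ → EuclideanSpace ℝ (Fin 3) → EuclideanSpace ℝ (Fin 3)} {c : ℝ≥0}
    (hA : ∀ a : ℝ, 0 < a → ENNReal.ofReal (a ^ (2 * ρ)) *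
      cknA a (0 : ℝ × EuclideanSpace ℝ (Fin 3)) u ≤ (c : ℝ≥0∞))
    {τ : ℝ} (hτ : τ < 0) {b : EuclideanSpace ℝ (Fin 3)} (hb : u τ =ᵐ[volume] fun _ => b) :
    ∫⁻ x, ‖u τ x‖ₑ ^ 2 = 0 := by
  have hb0 : b = 0 := by
    have hgrow : ∀ L : ℝ, Real.sqrt (-τ) + 1 ≤ L →
        ∫⁻ x in ball (0 : EuclideanSpace ℝ (Fin 3)) L, ‖(fun _ : EuclideanSpace ℝ (Fin 3) => b) x‖ₑ ^ 2 ≤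
          (c : ℝ≥0∞) * ENNReal.ofReal (L ^ (1 - 2 * ρ)) := by
      intro L hL
      have hs0 : 0 ≤ Real.sqrt (-τ) := Real.sqrt_nonneg _
      have hL0 : 0 < L := by linarith
      have hτL : τ ∈ Ioo (-(L ^ 2)) 0 := by
        refine ⟨?_, hτ⟩
        have h1 : Real.sqrt (-τ) ^ 2 = -τ := Real.sq_sqrt (by linarith)
        have h3 : Real.sqrt (-τ) ^ 2 < L ^ 2 := pow_lt_pow_left₀ (by linarith) hs0 two_ne_zero
        linarith
      have h := Backward.lintegral_ball_le_of_gaugeA hL0 (hA L hL0) hτL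
      have h' : ∫⁻ x in ball (0 : EuclideanSpace ℝ (Fin 3)) L, ‖(fun _ : EuclideanSpace ℝ (Fin 3) => b) x‖ₑ ^ 2 =
          ∫⁻ x in ball (0 : EuclideanSpace ℝ (Fin 3)) L, ‖u τ x‖ₑ ^ 2 := by
        refine lintegral_congr_ae (ae_restrict_of_ae ?_)
        filter_upwards [hb] with x hx
        rw [hx]
      rw [h', ← ENNReal.ofReal_coe_nnreal, ← ENNReal.ofReal_mul c.coe_nonneg]
      exact h
    obtain ⟨C, hC, hCgrow⟩ := Shifted.growth_of_growth_le (V := fun _ : EuclideanSpace ℝ (Fin 3) => b)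
      continuous_const (by linarith : 1 - 2 * ρ ≤ 3)
      (by linarith [Real.sqrt_nonneg (-τ)] : 1 ≤ Real.sqrt (-τ) + 1) ENNReal.coe_ne_top hgrow
    exact NoDrift.eq_zero_of_const_of_lintegral_ball_le hC (by linarith) hCgrow
  subst hb0
  have h1 : (fun x => ‖u τ x‖ₑ ^ 2) =ᵐ[volume] fun _ => 0 := by
    filter_upwards [hb] with x hx
    simp [hx]
  rw [lintegral_congr_ae h1, lintegral_zero]

/-- **Members of the power-gauged class with a TIME-PERIODIC PAST are trivial.**  Let `(u, p)` be a suitable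
weak Euler pair on `(−∞,0) × ℝ³` with weak spatial gradient `H` and gauges
`a^{2ρ} A(a) + a^{ρ} E(a) + a^{2ρ} D(a) ≤ c` (`ρ > 0`), and suppose `u(τ − P, ·) = u(τ, ·)` for every `τ < T₁`
(`T₁ ≤ 0`, `P > 0`).  Then `u = 0` a.e. on the slab.  The whole-slab case `T₁ = 0` is the tree's
`powerGaugeEulerLiouville_timePeriodic`; see the file docstring for the proof. [folklore] -/
theorem ae_eq_zero_of_gauge_of_pastTimePeriodic {ρ : ℝ} (hρ : 0 < ρ)
    {u : ℝ → EuclideanSpace ℝ (Fin 3) → EuclideanSpace ℝ (Fin 3)} {p : ℝ → EuclideanSpace ℝ (Fin 3) → ℝ}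
    {H : ℝ → EuclideanSpace ℝ (Fin 3) → EuclideanSpace ℝ (Fin 3) →L[ℝ] EuclideanSpace ℝ (Fin 3)} {c : ℝ≥0}
    (hsw : IsSuitableWeakSolutionOn (slab (EuclideanSpace ℝ (Fin 3)) (Iio 0) isOpen_Iio) 0 0 u p)
    (hH : HasWeakSpatialGradientOn (slab (EuclideanSpace ℝ (Fin 3)) (Iio 0) isOpen_Iio) u H)
    (hc : ∀ a : ℝ, 0 < a → ENNReal.ofReal (a ^ (2 * ρ)) * cknA a (0 : ℝ × EuclideanSpace ℝ (Fin 3)) u +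
        ENNReal.ofReal (a ^ ρ) * cknE a (0 : ℝ × EuclideanSpace ℝ (Fin 3)) H +
        ENNReal.ofReal (a ^ (2 * ρ)) * cknD a (0 : ℝ × EuclideanSpace ℝ (Fin 3)) p ≤ (c : ℝ≥0∞))
    {T₁ : ℝ} (hT₁ : T₁ ≤ 0) {P : ℝ} (hP : 0 < P)
    (hper : ∀ τ : ℝ, τ < T₁ → u (τ - P) = u τ) :
    uncurry u =ᵐ[volume.restrict (Iio (0 : ℝ) ×ˢ (univ : Set (EuclideanSpace ℝ (Fin 3))))] 0 := by
  have hE : ∀ a : ℝ, 0 < a →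
      ENNReal.ofReal (a ^ ρ) * cknE a (0 : ℝ × EuclideanSpace ℝ (Fin 3)) H ≤ (c : ℝ≥0∞) :=
    fun a ha => le_trans (le_trans le_add_self le_self_add) (hc a ha)
  have hA : ∀ a : ℝ, 0 < a → ENNReal.ofReal (a ^ (2 * ρ)) *
      cknA a (0 : ℝ × EuclideanSpace ℝ (Fin 3)) u ≤ (c : ℝ≥0∞) :=
    fun a ha => le_trans (le_trans le_self_add le_self_add) (hc a ha)
  have hprod : ∀ S : Set ℝ, (volume : Measure (ℝ × EuclideanSpace ℝ (Fin 3))).restrict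
      (S ×ˢ (univ : Set (EuclideanSpace ℝ (Fin 3)))) =
      (volume.restrict S).prod (volume : Measure (EuclideanSpace ℝ (Fin 3))) := by
    intro S
    rw [Measure.volume_eq_prod, Measure.restrict_prod_eq_prod_univ]
  -- ## (1) the time-translated past `ũ(s) = u(T₁ + s)`, `H̃(s) = H(T₁ + s)`
  set ut : ℝ → EuclideanSpace ℝ (Fin 3) → EuclideanSpace ℝ (Fin 3) := fun s y => u (T₁ + s) y with hut
  set Ht : ℝ → EuclideanSpace ℝ (Fin 3) → EuclideanSpace ℝ (Fin 3) →L[ℝ] EuclideanSpace ℝ (Fin 3) :=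
    fun s y => H (T₁ + s) y with hHt
  have hHt_grad : HasWeakSpatialGradientOn (slab (EuclideanSpace ℝ (Fin 3)) (Iio 0) isOpen_Iio) ut Ht := by
    have h1 := hH.stRescale 1 one_pos one_pos T₁ (0 : EuclideanSpace ℝ (Fin 3))
    have e1 : (1 : ℝ) • stPull 1 1 T₁ (0 : EuclideanSpace ℝ (Fin 3)) u = ut := by
      funext s y
      simp [hut, stPull_apply]
    have e2 : ((1 : ℝ) * 1) • stPull 1 1 T₁ (0 : EuclideanSpace ℝ (Fin 3)) H = Ht := by
      funext s y
      simp [hHt, stPull_apply]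
    rw [e1, e2] at h1
    refine h1.mono ?_
    intro z hz
    have hz' : z.1 < 0 := by simpa [mem_slab] using hz
    rw [mem_stPreimage, mem_slab]
    simp only [stAffine_fst, one_mul, mem_Iio]
    linarith
  have hut_per : ∀ s : ℝ, s < 0 → ut (s - P) = ut s := by
    intro s hs
    show (fun y => u (T₁ + (s - P)) y) = fun y => u (T₁ + s) y
    have h := hper (T₁ + s) (by linarith)
    rw [show T₁ + (s - P) = T₁ + s - P by ring]
    exact funext fun y => by rw [h]
  -- periodicity under the multiples `(N+1)P`
  have hut_perN : ∀ N : ℕ, ∀ s : ℝ, s < 0 → ut (s - ((N : ℝ) + 1) * P) = ut s := by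
    intro N
    induction N with
    | zero => intro s hs; simpa using hut_per s hs
    | succ N ih =>
      intro s hs
      have h1 : s - ((N : ℝ) + 1) * P < 0 := by
        have : 0 ≤ ((N : ℝ) + 1) * P := by positivity
        linarith
      have h2 := hut_per (s - ((N : ℝ) + 1) * P) h1
      rw [show s - ((N : ℝ) + 1) * P - P = s - (((N + 1 : ℕ) : ℝ) + 1) * P by push_cast; ring] at h2
      rw [h2, ih s hs]
  -- ## (2) the window bound for `H̃` from the `E`-gauge of `H` (large scales only)
  set Ft : ℝ × EuclideanSpace ℝ (Fin 3) → ℝ≥0∞ := fun z => ENNReal.ofReal (frobeniusNormSq (Ht z.1 z.2)) with hFt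
  have hwin : ∀ T R a : ℝ, 0 < a → R ≤ a → T - T₁ ≤ a ^ 2 → 0 ≤ T →
      ∫⁻ z in Ioo (-T) 0 ×ˢ ball (0 : EuclideanSpace ℝ (Fin 3)) R, Ft z ≤
        ENNReal.ofReal ((c : ℝ) * a ^ (1 - ρ)) := by
    intro T R a ha hRa hTa hT0
    have h1 := setLIntegral_prod_timeShift T₁ (T₁ - T) T₁ (ball (0 : EuclideanSpace ℝ (Fin 3)) R)
      (fun z : ℝ × EuclideanSpace ℝ (Fin 3) => ENNReal.ofReal (frobeniusNormSq (H z.1 z.2)))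
    rw [show T₁ - T - T₁ = -T by ring, show T₁ - T₁ = (0 : ℝ) by ring] at h1
    have h2 : ∫⁻ z in Ioo (-T) 0 ×ˢ ball (0 : EuclideanSpace ℝ (Fin 3)) R, Ft z =
        ∫⁻ z in Ioo (T₁ - T) T₁ ×ˢ ball (0 : EuclideanSpace ℝ (Fin 3)) R,
          ENNReal.ofReal (frobeniusNormSq (H z.1 z.2)) := by
      rw [← h1]
    rw [h2]
    have hsub : Ioo (T₁ - T) T₁ ×ˢ ball (0 : EuclideanSpace ℝ (Fin 3)) R ⊆
        Ioo (-(T - T₁)) 0 ×ˢ ball (0 : EuclideanSpace ℝ (Fin 3)) R :=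
      prod_mono (Ioo_subset_Ioo (by linarith) hT₁) le_rfl
    refine (lintegral_mono_set hsub).trans ?_
    exact TimePeriodic.setLIntegral_window_le_of_gaugeE ha hRa hTa (hE a ha)
  -- ## (3) every period box `(−(N+1)P, 0) × B_{N+1}` of `H̃` has zero mass
  have hbox0 : ∀ N : ℕ,
      ∫⁻ z in Ioo (-(((N : ℝ) + 1) * P)) 0 ×ˢ ball (0 : EuclideanSpace ℝ (Fin 3)) ((N : ℝ) + 1), Ft z = 0 := by
    intro N
    set P' : ℝ := ((N : ℝ) + 1) * P with hP'def
    have hP' : 0 < P' := by positivity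
    set R : ℝ := (N : ℝ) + 1 with hRdef
    have hR : 0 < R := by positivity
    have hperN := TimePeriodic.weakGradient_ae_shift_of_periodic hHt_grad hP'.le (hut_perN N)
    set J : ℝ≥0∞ := ∫⁻ z in Ioo (-P') 0 ×ˢ ball (0 : EuclideanSpace ℝ (Fin 3)) R, Ft z with hJ
    set K : ℝ := (c : ℝ) * (Real.sqrt (P' - T₁) + R + 1) with hK
    have hK0 : 0 ≤ K := by
      have := Real.sqrt_nonneg (P' - T₁)
      have : (0 : ℝ) ≤ c := c.coe_nonneg
      positivity
    have key : ∀ n : ℕ, 1 ≤ n → J ≤ ENNReal.ofReal (K / Real.sqrt n) := by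
      intro n hn
      have hn0 : (0 : ℝ) < n := by exact_mod_cast hn
      have hn1 : (1 : ℝ) ≤ n := by exact_mod_cast hn
      set a : ℝ := Real.sqrt ((n : ℝ) * P' - T₁) + R + 1 with ha
      have hsq0 : 0 ≤ Real.sqrt ((n : ℝ) * P' - T₁) := Real.sqrt_nonneg _
      have ha1 : 1 ≤ a := by linarith
      have ha0 : 0 < a := by linarith
      have hRa : R ≤ a := by linarith
      have hnPT : 0 ≤ (n : ℝ) * P' - T₁ := by nlinarith
      have hTa : (n : ℝ) * P' - T₁ ≤ a ^ 2 := by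
        have h1 : Real.sqrt ((n : ℝ) * P' - T₁) ^ 2 = (n : ℝ) * P' - T₁ := Real.sq_sqrt hnPT
        nlinarith
      have hpack := TimePeriodic.mul_periodBox_le hP'.le hperN
        (measurableSet_ball : MeasurableSet (ball (0 : EuclideanSpace ℝ (Fin 3)) R)) n
      have hw := hwin ((n : ℝ) * P') R a ha0 hRa hTa (by positivity)
      have h1 : (n : ℝ≥0∞) * J ≤ ENNReal.ofReal ((c : ℝ) * a ^ (1 - ρ)) := hpack.trans hw
      -- real bound: `c a^{1-ρ} / n ≤ K / √n`
      have h2 : a ^ (1 - ρ) ≤ a := by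
        calc a ^ (1 - ρ) ≤ a ^ (1 : ℝ) := Real.rpow_le_rpow_of_exponent_le ha1 (by linarith)
          _ = a := Real.rpow_one a
      have hs1 : 1 ≤ Real.sqrt n := by
        rw [show (1 : ℝ) = Real.sqrt 1 by simp]
        exact Real.sqrt_le_sqrt hn1
      have hs2 : Real.sqrt ((n : ℝ) * P' - T₁) ≤ Real.sqrt (P' - T₁) * Real.sqrt n := by
        rw [← Real.sqrt_mul (by linarith : 0 ≤ P' - T₁)]
        exact Real.sqrt_le_sqrt (by nlinarith)
      have h3 : a ≤ (Real.sqrt (P' - T₁) + R + 1) * Real.sqrt n := by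
        have := Real.sqrt_nonneg (P' - T₁)
        nlinarith
      have hc0 : (0 : ℝ) ≤ c := c.coe_nonneg
      have h4 : (c : ℝ) * a ^ (1 - ρ) ≤ K * Real.sqrt n := by
        calc (c : ℝ) * a ^ (1 - ρ) ≤ (c : ℝ) * a := by gcongr
          _ ≤ (c : ℝ) * ((Real.sqrt (P' - T₁) + R + 1) * Real.sqrt n) := by gcongr
          _ = K * Real.sqrt n := by rw [hK]; ring
      have hsn0 : 0 < Real.sqrt n := Real.sqrt_pos.2 hn0
      have h5 : (c : ℝ) * a ^ (1 - ρ) / n ≤ K / Real.sqrt n := by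
        rw [div_le_div_iff₀ hn0 hsn0]
        have hnn : Real.sqrt n * Real.sqrt n = n := Real.mul_self_sqrt hn0.le
        nlinarith
      -- `J ≤ ofReal (c a^{1-ρ} / n)`
      have hn0' : (n : ℝ≥0∞) ≠ 0 := by exact_mod_cast (by omega : n ≠ 0)
      have hnT : (n : ℝ≥0∞) ≠ ⊤ := ENNReal.natCast_ne_top n
      have h6 : J ≤ ENNReal.ofReal ((c : ℝ) * a ^ (1 - ρ) / n) := by
        calc J = (n : ℝ≥0∞)⁻¹ * ((n : ℝ≥0∞) * J) := by
              rw [← mul_assoc, ENNReal.inv_mul_cancel hn0' hnT, one_mul]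
          _ ≤ (n : ℝ≥0∞)⁻¹ * ENNReal.ofReal ((c : ℝ) * a ^ (1 - ρ)) := by gcongr
          _ = ENNReal.ofReal ((c : ℝ) * a ^ (1 - ρ) / n) := by
              rw [← ENNReal.ofReal_natCast n, ← ENNReal.ofReal_inv_of_pos hn0,
                ← ENNReal.ofReal_mul (by positivity)]
              congr 1
              field_simp
      exact h6.trans (ENNReal.ofReal_le_ofReal h5)
    have hlim : Tendsto (fun n : ℕ => ENNReal.ofReal (K / Real.sqrt n)) atTop (𝓝 0) := by
      have h1 : Tendsto (fun n : ℕ => K / Real.sqrt (n : ℝ)) atTop (𝓝 0) :=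
        tendsto_const_nhds.div_atTop (Real.tendsto_sqrt_atTop.comp tendsto_natCast_atTop_atTop)
      have h := ENNReal.tendsto_ofReal h1
      rwa [ENNReal.ofReal_zero] at h
    refine le_antisymm (ge_of_tendsto hlim ?_) zero_le
    exact (eventually_ge_atTop 1).mono fun n hn => key n hn
  -- ## (4) `H̃ = 0` a.e. on the slab
  have hFtm : AEMeasurable Ft (volume.restrict (Iio (0 : ℝ) ×ˢ (univ : Set (EuclideanSpace ℝ (Fin 3))))) := by
    have h1 : AEStronglyMeasurable (uncurry Ht)
        (volume.restrict (Iio (0 : ℝ) ×ˢ (univ : Set (EuclideanSpace ℝ (Fin 3))))) := by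
      have := hHt_grad.locallyIntegrableOn_grad.aestronglyMeasurable
      simpa [slab] using this
    exact ((ENNReal.continuous_ofReal.comp LerayHopfProofs.continuous_frobeniusNormSq).comp_aestronglyMeasurable
      h1).aemeasurable
  have hHt0 : ∀ᵐ z ∂(volume.restrict (Iio (0 : ℝ) ×ˢ (univ : Set (EuclideanSpace ℝ (Fin 3))))),
      Ht z.1 z.2 = 0 := by
    -- adapted from Theorems/EulerZoomLiouvillePowerGaugeEulerLiouvilleTimePeriodic.lean
    have hbox : ∀ N : ℕ, ∀ᵐ z ∂(volume.restrict
        (Ioo (-(((N : ℝ) + 1) * P)) 0 ×ˢ ball (0 : EuclideanSpace ℝ (Fin 3)) ((N : ℝ) + 1))), Ft z = 0 := by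
      intro N
      have hsub : Ioo (-(((N : ℝ) + 1) * P)) 0 ×ˢ ball (0 : EuclideanSpace ℝ (Fin 3)) ((N : ℝ) + 1) ⊆
          Iio (0 : ℝ) ×ˢ (univ : Set (EuclideanSpace ℝ (Fin 3))) :=
        prod_mono (fun τ hτ => hτ.2) (subset_univ _)
      exact (lintegral_eq_zero_iff' (hFtm.mono_set hsub)).1 (hbox0 N)
    have hU : (Iio (0 : ℝ) ×ˢ (univ : Set (EuclideanSpace ℝ (Fin 3)))) =
        ⋃ N : ℕ, (Ioo (-(((N : ℝ) + 1) * P)) 0 ×ˢ ball (0 : EuclideanSpace ℝ (Fin 3)) ((N : ℝ) + 1)) := by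
      ext z
      simp only [mem_prod, mem_Iio, mem_univ, and_true, mem_iUnion, mem_Ioo, mem_ball_zero_iff]
      constructor
      · intro hz
        obtain ⟨N, hN⟩ := exists_nat_gt (max (-z.1 / P) ‖z.2‖)
        refine ⟨N, ⟨?_, hz⟩, ?_⟩
        · have h1 : -z.1 / P < (N : ℝ) + 1 := by linarith [le_max_left (-z.1 / P) ‖z.2‖]
          rw [div_lt_iff₀ hP] at h1
          linarith
        · linarith [le_max_right (-z.1 / P) ‖z.2‖]
      · rintro ⟨N, ⟨-, h2⟩, -⟩
        exact h2
    rw [hU, ae_restrict_iUnion_iff]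
    intro N
    filter_upwards [hbox N] with z hz
    have h1 : frobeniusNormSq (Ht z.1 z.2) ≤ 0 := ENNReal.ofReal_eq_zero.1 hz
    have h2 : ‖Ht z.1 z.2‖ ^ 2 ≤ 0 := (sq_opNorm_le_frobeniusNormSq _).trans h1
    exact norm_eq_zero.1 (by nlinarith [norm_nonneg (Ht z.1 z.2)])
  -- ## (5) a.e. slice of `ũ` has the zero weak derivative, is a.e. constant, has zero energy
  have hsliceT : ∀ᵐ s ∂(volume.restrict (Iio (0 : ℝ))),
      HasWeakFDerivOn (⊤ : Opens (EuclideanSpace ℝ (Fin 3))) volume (ut s) (Ht s) := by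
    have hcov : Iio (0 : ℝ) = ⋃ N : ℕ, Ioo (-((N : ℝ) + 1)) 0 := by
      refine subset_antisymm (fun t ht => ?_) (iUnion_subset fun n t ht => ht.2)
      obtain ⟨n, hn⟩ := exists_nat_gt (-t)
      exact mem_iUnion.2 ⟨n, ⟨by linarith, ht⟩⟩
    rw [hcov, ae_restrict_iUnion_iff]
    intro N
    have hmono : slab (EuclideanSpace ℝ (Fin 3)) (Ioo (-((N : ℝ) + 1)) 0) isOpen_Ioo ≤
        slab (EuclideanSpace ℝ (Fin 3)) (Iio 0) isOpen_Iio := slab_mono Ioo_subset_Iio_self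
    exact (hHt_grad.mono hmono).ae_hasWeakFDerivOn_slice (Ω := ⊤)
  have hzeroT : ∀ᵐ s ∂(volume.restrict (Iio (0 : ℝ))), ∀ᵐ y ∂(volume : Measure (EuclideanSpace ℝ (Fin 3))),
      Ht s y = 0 := by
    rw [hprod] at hHt0
    exact Measure.ae_ae_of_ae_prod hHt0
  have hs0 : ∀ᵐ s ∂(volume.restrict (Iio (0 : ℝ))), s < 0 := by
    rw [ae_restrict_iff' measurableSet_Iio]
    exact Eventually.of_forall fun s hs => hs
  have henergyT : ∀ᵐ s ∂(volume.restrict (Iio (0 : ℝ))), ∫⁻ x, ‖u (T₁ + s) x‖ₑ ^ 2 = 0 := by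
    filter_upwards [hsliceT, hzeroT, hs0] with s hW hz hs
    have hW0 : HasWeakFDerivOn (⊤ : Opens (EuclideanSpace ℝ (Fin 3))) volume (ut s) 0 :=
      { locallyIntegrableOn := hW.locallyIntegrableOn
        locallyIntegrableOn_deriv :=
          (locallyIntegrable_const (0 : EuclideanSpace ℝ (Fin 3) →L[ℝ] EuclideanSpace ℝ (Fin 3))
            ).locallyIntegrableOn _
        integral_fderiv_smul_eq := fun φ w hφ => by
          rw [hW.integral_fderiv_smul_eq φ w hφ]
          congr 1
          refine integral_congr_ae ?_
          filter_upwards [ae_restrict_of_ae hz] with y hy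
          simp [hy] }
    obtain ⟨b, hb⟩ := ae_eq_const_of_hasWeakFDerivOn_zero hW0
    have hτ : T₁ + s < 0 := by linarith
    exact lintegral_slice_eq_zero_of_ae_const_of_gaugeA hρ hA hτ hb
  -- ## (6) back to `u`: a.e. `τ < T₁` has zero energy, so the past is energy-quiescent
  have hnullT : volume ({s : ℝ | ¬ ∫⁻ x, ‖u (T₁ + s) x‖ₑ ^ 2 = 0} ∩ Iio 0) = 0 := by
    have h := henergyT
    rw [ae_iff, Measure.restrict_apply' measurableSet_Iio] at h
    exact h
  have hnull : volume ({τ : ℝ | ¬ ∫⁻ x, ‖u τ x‖ₑ ^ 2 = 0} ∩ Iio T₁) = 0 := by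
    have hpre : (fun s : ℝ => T₁ + s) ⁻¹' ({τ : ℝ | ¬ ∫⁻ x, ‖u τ x‖ₑ ^ 2 = 0} ∩ Iio T₁) =
        {s : ℝ | ¬ ∫⁻ x, ‖u (T₁ + s) x‖ₑ ^ 2 = 0} ∩ Iio 0 := by
      ext s
      simp only [preimage_inter, preimage_setOf_eq, mem_inter_iff, mem_setOf_eq, mem_preimage, mem_Iio]
      constructor
      · rintro ⟨h1, h2⟩; exact ⟨h1, by linarith⟩
      · rintro ⟨h1, h2⟩; exact ⟨h1, by linarith⟩
    rw [← measure_preimage_add volume T₁, hpre]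
    exact hnullT
  refine ae_eq_zero_of_gauge_of_energyVanishing_allRho hρ.le hsw hH hc fun ε _ N => ?_
  set m : ℝ := min (-N) T₁ with hm
  intro h0
  have hsub : Iio m ⊆ {s : ℝ | s < -N ∧ ∫⁻ x, ‖u s x‖ₑ ^ 2 ≤ ENNReal.ofReal ε} ∪
      ({τ : ℝ | ¬ ∫⁻ x, ‖u τ x‖ₑ ^ 2 = 0} ∩ Iio T₁) := by
    intro s hs
    have hsN : s < -N := lt_of_lt_of_le hs (min_le_left _ _)
    have hsT : s < T₁ := lt_of_lt_of_le hs (min_le_right _ _)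
    by_cases hz : ∫⁻ x, ‖u s x‖ₑ ^ 2 = 0
    · left
      refine ⟨hsN, ?_⟩
      rw [hz]
      exact zero_le
    · right
      exact ⟨hz, hsT⟩
  have h2 : volume (Iio m) ≤ 0 :=
    calc volume (Iio m) ≤ volume ({s : ℝ | s < -N ∧ ∫⁻ x, ‖u s x‖ₑ ^ 2 ≤ ENNReal.ofReal ε} ∪
          ({τ : ℝ | ¬ ∫⁻ x, ‖u τ x‖ₑ ^ 2 = 0} ∩ Iio T₁)) := measure_mono hsub
      _ ≤ volume {s : ℝ | s < -N ∧ ∫⁻ x, ‖u s x‖ₑ ^ 2 ≤ ENNReal.ofReal ε} +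
          volume ({τ : ℝ | ¬ ∫⁻ x, ‖u τ x‖ₑ ^ 2 = 0} ∩ Iio T₁) := measure_union_le _ _
      _ = 0 := by rw [h0, hnull, add_zero]
  rw [Real.volume_Iio] at h2
  exact absurd h2 (by simp)

end Summit.NavierStokesRegularity.NavierStokesRegularity.Theorems.PowerGaugeEulerLiouville.PastPeriodic
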